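/-
Copyright (c) 2026. Released under Apache 2.0 license as described in the file LICENSE.
-/
import Summits.RiemannHypothesis.RiemannHypothesis.Theorems.LiDirichletKernelEncl
import HarnessLib

/-!
# KERNEL LINEAGE K-χ — soundness I (part 2): the coefficient list of one residue class

RH-FREE DATA machinery.  bears_on: LADDER-RH L-D (Dirichlet rows).  WHAT THIS IS NOT: nothing here bears on
the truth of RH or GRH.

The head power sums (`headPass`, `facScale`), the fine-scale Bernoulli coefficients (`betaList`, `gListMI`), and —
assembling these — `progCoeffs_spec`: the list `progCoeffs … q m …` encloses the real Taylor coefficients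
`[wⁱ]P_m(w)` of the Euler–Maclaurin exponential polynomial of the residue class `m`
(`DirichletLTaylor.emMainOneProgCoeff`, `Literature/NumberTheory/LFunctions/DirichletLOneTaylorEM.lean`;
`emMainOneProgCoeff_eq_ofReal`, `progCoeffR_eq`).
-/

set_option linter.dupNamespace false

namespace Summit.RiemannHypothesis.RiemannHypothesis.Theorems.LiDirichletKernel

open Literature.Analysis.ValidatedNumerics Literature.Analysis.ValidatedNumerics.NumericsMP
open Literature.NumberTheory.LFunctions Literature.NumberTheory.LFunctions.Xiao2020
open Literature.NumberTheory.LFunctions.Xiao2020.CertKernel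
open Finset
open scoped Nat

variable {S : ℕ}

/-! ## Head power sums -/

/-- Length of `powRow`. -/
@[simp] theorem length_powRow (S : ℕ) (Y : MI) : ∀ (cur : MI) (c : ℕ), (powRow S Y cur c).length = c
  | _, 0 => rfl
  | cur, c + 1 => by simp [powRow, length_powRow]

/-- `powRow S Y cur c` encloses `j ↦ a · yʲ` when `cur ∋ a`, `Y ∋ y`. -/
theorem encl_powRow (hS : 0 < S) {y : ℝ} {Y : MI} (hY : MI.mem S y Y) :
    ∀ (a : ℝ) (cur : MI) (c : ℕ), MI.mem S a cur → Encl S (fun j ↦ a * y ^ j) (powRow S Y cur c)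
  | _, _, 0, _ => trivial
  | a, cur, c + 1, ha => by
    simp only [powRow]
    refine ⟨by simpa using ha, ?_⟩
    have := encl_powRow hS hY (a * y) (cur.mul S Y) c (MI.mem_mul hS ha hY)
    exact this.congr' fun j ↦ by ring

/-- Length of `headPass`. -/
theorem length_headPass (S len q m : ℕ) (Ls : List MI) : ∀ (c : ℕ) (acc : List MI),
    acc.length = len → (headPass S len q m Ls c acc).length = len
  | 0, _, h => h
  | c + 1, acc, h => by
    simp only [headPass]
    exact length_headPass S len q m Ls c _ (by simp [h])

/-- The head term `(−log(nq+m))ʲ/(nq+m)`. -/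
noncomputable def headTerm (q m n j : ℕ) : ℝ :=
  (-Real.log ((n * q + m : ℕ) : ℝ)) ^ j / ((n * q + m : ℕ) : ℝ)

/-- `headPass` adds `Σ_{n<c} (−log(nq+m))ʲ/(nq+m)` to what `acc` encloses. -/
theorem encl_headPass (hS : 0 < S) {len q m : ℕ} (hm : 1 ≤ m) {Ls : List MI}
    (hLs : Encl S (fun i ↦ Real.log ((i + 1 : ℕ) : ℝ)) Ls) :
    ∀ (c : ℕ) (acc : List MI) (g : ℕ → ℝ), (c = 0 ∨ (c - 1) * q + m ≤ Ls.length) → Encl S g acc →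
      Encl S (fun j ↦ g j + ∑ n ∈ range c, headTerm q m n j) (headPass S len q m Ls c acc)
  | 0, acc, g, _, hacc => by simpa [headPass] using hacc
  | c + 1, acc, g, hc, hacc => by
    simp only [headPass]
    have hidx : c * q + m ≤ Ls.length := by
      rcases hc with h | h
      · omega
      · simpa using h
    have hpos : 1 ≤ c * q + m := le_add_left hm
    have hL : MI.mem S (Real.log ((c * q + m : ℕ) : ℝ)) (Ls.getD (c * q + m - 1) zeroI) := by
      have := hLs.getD (i := c * q + m - 1) (by omega)
      rwa [show c * q + m - 1 + 1 = c * q + m by omega] at this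
    have hrow : Encl S (fun j ↦ headTerm q m c j)
        (powRow S (Ls.getD (c * q + m - 1) zeroI).neg (fracBox S 1 (c * q + m)) len) := by
      have := encl_powRow hS (MI.mem_neg hL) (((1 : ℕ) : ℝ) / (c * q + m : ℕ)) (fracBox S 1 (c * q + m)) len
        (mem_fracBox S 1 (by omega))
      refine this.congr' fun j ↦ ?_
      rw [headTerm]
      push_cast
      ring
    have hc' : c = 0 ∨ (c - 1) * q + m ≤ Ls.length := by
      rcases Nat.eq_zero_or_pos c with h | h
      · exact Or.inl h
      · right
        have : (c - 1) * q ≤ c * q := Nat.mul_le_mul_right _ (Nat.sub_le _ _)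
        omega
    have := encl_headPass hS (len := len) hm hLs c _ (fun j ↦ g j + headTerm q m c j) hc' (encl_addL hacc hrow)
    refine this.congr' fun j ↦ ?_
    rw [sum_range_succ, add_assoc, add_comm (headTerm q m c j)]

/-- Length of `facScale`. -/
@[simp] theorem length_facScale : ∀ (L : List MI) (j f : ℕ), (facScale L j f).length = L.length
  | [], _, _ => rfl
  | I :: L, j, f => by simp [facScale, length_facScale]

/-- `facScale L j (j!)` divides entry `i` by `(j+i)!`. -/
theorem encl_facScale {a : ℕ → ℝ} : ∀ (L : List MI) (j f : ℕ), f = j ! → Encl S a L →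
    Encl S (fun i ↦ a i / ((j + i)! : ℝ)) (facScale L j f)
  | [], _, _, _, _ => trivial
  | I :: L, j, f, hf, h => by
    simp only [facScale]
    refine ⟨?_, ?_⟩
    · have := MI.mem_divNat h.1 (n := f) (by rw [hf]; exact Nat.factorial_pos j)
      simpa [hf] using this
    · have := encl_facScale L (j + 1) (f * (j + 1)) (by rw [hf, Nat.factorial_succ]; ring) h.2
      exact this.congr' fun i ↦ by rw [show j + 1 + i = j + (i + 1) by omega]

/-! ## The Bernoulli coefficients at the fine scale -/

/-- The real Bernoulli coefficient `g_l = Σ_{k=1}^{ν} (B_{2k}/(2k)!) q^{2k−1} M^{−2k} pochCoeff(2k−1, l)`. -/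
noncomputable def gProgR (q M ν l : ℕ) : ℝ :=
  ∑ k ∈ Icc 1 ν,
    (bernoulli (2 * k) : ℝ) / (2 * k)! * (q : ℝ) ^ (2 * k - 1) * (((M : ℝ)) ^ (2 * k))⁻¹ * (pochCoeff (2 * k - 1) l : ℝ)

/-- `β_k = c_k q^{2k−1}/M^{2k}` as a function of `j = k − 1`. -/
noncomputable def betaR (q M j : ℕ) : ℝ :=
  (ZetaNumerics.emCoeff (j + 1) : ℝ) * (q : ℝ) ^ (2 * j + 1) / (M : ℝ) ^ (2 * (j + 1))

/-- Length of `betaList`. -/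
@[simp] theorem length_betaList (S₂ : ℕ) (cs : List ℚ) (q M ν : ℕ) : (betaList S₂ cs q M ν).length = ν := by
  simp [betaList]

/-- `betaList` encloses `β`. -/
theorem encl_betaList (S₂ : ℕ) {cs : List ℚ} {q M ν : ℕ} (hM : 0 < M)
    (hcs : ∀ j < ν, cs.getD (j + 1) 0 = ZetaNumerics.emCoeff (j + 1)) :
    Encl S₂ (betaR q M) (betaList S₂ cs q M ν) := by
  rw [encl_iff_getD]
  intro j hj
  rw [length_betaList] at hj
  have hget : (betaList S₂ cs q M ν).getD j zeroI =
      zfracBox S₂ ((cs.getD (j + 1) 0).num * (q : ℤ) ^ (2 * j + 1))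
        ((cs.getD (j + 1) 0).den * M ^ (2 * (j + 1))) := by
    rw [betaList, List.getD_eq_getElem?_getD, List.getElem?_map, List.getElem?_range hj]
    simp
  rw [hget]
  have hden : 0 < (cs.getD (j + 1) 0).den * M ^ (2 * (j + 1)) :=
    Nat.mul_pos (Rat.den_pos _) (Nat.pow_pos hM)
  have := mem_zfracBox S₂ ((cs.getD (j + 1) 0).num * (q : ℤ) ^ (2 * j + 1)) hden
  refine (show betaR q M j = _ from ?_) ▸ this
  rw [betaR, ← hcs j hj]
  set c := cs.getD (j + 1) 0 with hc
  have hcq : (c : ℝ) = (c.num : ℝ) / (c.den : ℝ) := by exact_mod_cast (Rat.num_div_den c).symm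
  rw [hcq]
  have hd : (c.den : ℝ) ≠ 0 := by exact_mod_cast c.den_pos.ne'
  have hMr : (M : ℝ) ≠ 0 := by exact_mod_cast hM.ne'
  push_cast
  field_simp

/-- Length of `gListMI`. -/
@[simp] theorem length_gListMI (S₂ S : ℕ) (betas : List MI) (PR : List (List ℕ)) (ν : ℕ) :
    (gListMI S₂ S betas PR ν).length = 2 * ν := by
  simp [gListMI]

/-- `gListMI` encloses `g_l`. -/
theorem encl_gListMI {S₂ : ℕ} (hS₂ : 0 < S₂) (S : ℕ) {q M ν : ℕ} {betas : List MI}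
    (hb : Encl S₂ (betaR q M) betas) (hbl : betas.length = ν) :
    Encl S (gProgR q M ν) (gListMI S₂ S betas (pochRows ν) ν) := by
  rw [encl_iff_getD]
  intro l hl
  rw [length_gListMI] at hl
  have hget : (gListMI S₂ S betas (pochRows ν) ν).getD l zeroI =
      (dotZ ((List.range ν).map fun j ↦ ((((pochRows ν).getD j []).getD l 0 : ℕ) : ℤ)) betas).rescale S₂ S := by
    rw [gListMI, List.getD_eq_getElem?_getD, List.getElem?_map, List.getElem?_range hl]
    simp
  rw [hget]
  refine MI.mem_rescale hS₂ S ?_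
  have hdot := mem_dotZ ((List.range ν).map fun j ↦ ((((pochRows ν).getD j []).getD l 0 : ℕ) : ℤ)) hb
  refine (show gProgR q M ν l = _ from ?_) ▸ hdot
  rw [List.length_map, List.length_range, hbl, min_self, gProgR, ← Finset.Ico_add_one_right_eq_Icc,
    Finset.sum_Ico_eq_sum_range, Nat.add_sub_cancel]
  refine sum_congr rfl fun j hj ↦ ?_
  rw [mem_range] at hj
  rw [List.getD_eq_getElem?_getD, List.getElem?_map, List.getElem?_range hj]
  simp only [Option.map_some, Option.getD_some]
  rw [pochRows_getD hj, betaR, ZetaNumerics.emCoeff, show 1 + j = j + 1 by ring]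
  simp only [show 2 * (j + 1) - 1 = 2 * j + 1 by omega]
  push_cast
  ring

/-! ## The coefficient list of one residue class -/

/-- The real form of `[wⁱ]P_m(w)` (same shape as `DirichletLTaylor.emMainOneProgCoeff`). -/
noncomputable def progCoeffR (q m N ν i : ℕ) : ℝ :=
  (∑ n ∈ range N, (((n * q + m : ℕ) : ℝ))⁻¹ * expMonCoeffR 1 (-Real.log ((n * q + m : ℕ) : ℝ)) i) +
  (q : ℝ)⁻¹ * expMonCoeffR 0 (-Real.log ((N * q + m : ℕ) : ℝ)) i +
  (2 * ((N * q + m : ℕ) : ℝ))⁻¹ * expMonCoeffR 1 (-Real.log ((N * q + m : ℕ) : ℝ)) i +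
  ∑ p ∈ (Icc 1 ν).sigma (fun k ↦ range (2 * k)),
    ((bernoulli (2 * p.1) : ℝ) / (2 * p.1)! * (q : ℝ) ^ (2 * p.1 - 1) *
        ((((N * q + m : ℕ) : ℝ)) ^ (2 * p.1))⁻¹ * (pochCoeff (2 * p.1 - 1) p.2 : ℝ)) *
      expMonCoeffR (p.2 + 1) (-Real.log ((N * q + m : ℕ) : ℝ)) i

/-- `[wⁱ]P_m` is real: `emMainOneProgCoeff = progCoeffR`. -/
theorem emMainOneProgCoeff_eq_ofReal (q m N ν i : ℕ) :
    DirichletLTaylor.emMainOneProgCoeff q m N ν i = (progCoeffR q m N ν i : ℂ) := by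
  simp only [DirichletLTaylor.emMainOneProgCoeff, progCoeffR, ← Complex.ofReal_natCast, ← Complex.ofReal_neg,
    expMonCoeff_ofReal]
  push_cast
  ring

/-- The head summand in the form the program computes it: `[1 ≤ i]·(−log(nq+m))^{i−1}/((i−1)!·(nq+m))`. -/
noncomputable def headTermScaled (q m N i : ℕ) : ℝ :=
  if 1 ≤ i then (∑ n ∈ range N, headTerm q m n (i - 1)) / ((i - 1)! : ℝ) else 0

/-- The reorganised form of `progCoeffR` computed by `progCoeffs`. -/
theorem progCoeffR_eq (q m N ν i : ℕ) : progCoeffR q m N ν i =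
    headTermScaled q m N i + (-Real.log ((N * q + m : ℕ) : ℝ)) ^ i / i ! / q +
    (2 * ((N * q + m : ℕ) : ℝ))⁻¹ * expMonCoeffR 1 (-Real.log ((N * q + m : ℕ) : ℝ)) i +
    ∑ l ∈ range (2 * ν), gProgR q (N * q + m) ν l * expMonCoeffR (l + 1) (-Real.log ((N * q + m : ℕ) : ℝ)) i := by
  unfold progCoeffR
  have h1 : ∑ n ∈ range N, (((n * q + m : ℕ) : ℝ))⁻¹ * expMonCoeffR 1 (-Real.log ((n * q + m : ℕ) : ℝ)) i =
      headTermScaled q m N i := by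
    unfold headTermScaled expMonCoeffR headTerm
    split_ifs with hi
    · rw [sum_div]
      refine sum_congr rfl fun n _ ↦ ?_
      ring
    · simp
  have h2 : (q : ℝ)⁻¹ * expMonCoeffR 0 (-Real.log ((N * q + m : ℕ) : ℝ)) i =
      (-Real.log ((N * q + m : ℕ) : ℝ)) ^ i / i ! / q := by
    simp [expMonCoeffR]; ring
  have h4 : ∑ p ∈ (Icc 1 ν).sigma (fun k ↦ range (2 * k)),
      ((bernoulli (2 * p.1) : ℝ) / (2 * p.1)! * (q : ℝ) ^ (2 * p.1 - 1) *
          ((((N * q + m : ℕ) : ℝ)) ^ (2 * p.1))⁻¹ * (pochCoeff (2 * p.1 - 1) p.2 : ℝ)) *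
        expMonCoeffR (p.2 + 1) (-Real.log ((N * q + m : ℕ) : ℝ)) i =
      ∑ l ∈ range (2 * ν), gProgR q (N * q + m) ν l *
        expMonCoeffR (l + 1) (-Real.log ((N * q + m : ℕ) : ℝ)) i := by
    rw [sum_sigma]
    have : ∀ k ∈ Icc 1 ν, ∑ l ∈ range (2 * k),
        ((bernoulli (2 * k) : ℝ) / (2 * k)! * (q : ℝ) ^ (2 * k - 1) * ((((N * q + m : ℕ) : ℝ)) ^ (2 * k))⁻¹ *
          (pochCoeff (2 * k - 1) l : ℝ)) * expMonCoeffR (l + 1) (-Real.log ((N * q + m : ℕ) : ℝ)) i =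
        ∑ l ∈ range (2 * ν),
        ((bernoulli (2 * k) : ℝ) / (2 * k)! * (q : ℝ) ^ (2 * k - 1) * ((((N * q + m : ℕ) : ℝ)) ^ (2 * k))⁻¹ *
          (pochCoeff (2 * k - 1) l : ℝ)) * expMonCoeffR (l + 1) (-Real.log ((N * q + m : ℕ) : ℝ)) i := by
      intro k hk
      rw [mem_Icc] at hk
      refine sum_subset (range_subset_range.2 (by omega)) fun l _ hl ↦ ?_
      rw [mem_range, not_lt] at hl
      rw [pochCoeff_eq_zero_of_lt (by omega)]
      simp
    rw [sum_congr rfl this, sum_comm]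
    refine sum_congr rfl fun l _ ↦ ?_
    rw [gProgR, sum_mul]
  rw [h1, h2, h4]

/-- Length of `progCoeffs`. -/
theorem length_progCoeffs (S E len q m N ν : ℕ) (cs : List ℚ) (PR : List (List ℕ)) (Ls : List MI) :
    (progCoeffs S E len q m N ν cs PR Ls).length = len + 1 := by
  simp [progCoeffs, length_headPass S len q m Ls N (List.replicate len zeroI) (by simp)]

/-- **What `progCoeffs` computes**: boxes of the Taylor coefficients `[wⁱ]P_m(w)`, `i = 0, …, len`, of the
Euler–Maclaurin exponential polynomial of the residue class `m mod q` (`1 ≤ m`, `N ≥ 1`; the logarithm table must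
reach `log (Nq + m)`). -/
theorem progCoeffs_spec (hS : 0 < S) {E len q m N ν : ℕ} (hq : 0 < q) (hm : 1 ≤ m) {cs : List ℚ}
    (hcs : ∀ j < ν, cs.getD (j + 1) 0 = ZetaNumerics.emCoeff (j + 1)) {Ls : List MI}
    (hLs : Encl S (fun i ↦ Real.log ((i + 1 : ℕ) : ℝ)) Ls) (hLsl : N * q + m ≤ Ls.length) :
    Encl S (progCoeffR q m N ν) (progCoeffs S E len q m N ν cs (pochRows ν) Ls) := by
  set M := N * q + m with hM
  have hM0 : 0 < M := by rw [hM]; exact lt_of_lt_of_le hm (Nat.le_add_left _ _)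
  have hS₂ : 0 < S * 2 ^ E := Nat.mul_pos hS (Nat.pow_pos two_pos)
  have hLM : MI.mem S (Real.log (M : ℝ)) (Ls.getD (M - 1) zeroI) := by
    have := hLs.getD (i := M - 1) (by omega)
    rwa [show M - 1 + 1 = M by omega] at this
  -- A: head power sums, factorial-scaled, shifted by one
  have hH := encl_headPass hS (len := len) (q := q) hm hLs N (List.replicate len zeroI) (fun _ ↦ (0 : ℝ))
    (by
      rcases Nat.eq_zero_or_pos N with h | h
      · exact Or.inl h
      · right
        have : (N - 1) * q ≤ N * q := Nat.mul_le_mul_right _ (Nat.sub_le _ _)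
        omega)
    (encl_replicate_zeroI S len)
  have hF := encl_facScale _ 0 1 (by simp) hH
  have hA : Encl S (headTermScaled q m N)
      (zeroI :: facScale (headPass S len q m Ls N (List.replicate len zeroI)) 0 1) := by
    refine ⟨by simpa [headTermScaled] using mem_zeroI S, hF.congr' fun i ↦ ?_⟩
    simp only [headTermScaled, show 1 ≤ i + 1 from by omega, if_true, Nat.add_sub_cancel, zero_add]
  -- B, C: the polar and half terms
  have hrow := encl_trow hS (MI.mem_neg hLM) (len + 1)
  have hB : Encl S (fun i ↦ (-Real.log (M : ℝ)) ^ i / i ! / q)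
      ((trow S (Ls.getD (M - 1) zeroI).neg (len + 1)).map fun t ↦ t.divNat q) :=
    (encl_map_divNat hrow (n := q) hq).congr' fun i ↦ by simp
  have hC : Encl S (fun i ↦ (2 * (M : ℝ))⁻¹ * expMonCoeffR 1 (-Real.log (M : ℝ)) i)
      (zeroI :: (trow S (Ls.getD (M - 1) zeroI).neg (len + 1)).map fun t ↦ t.divNat (2 * M)) := by
    refine ⟨by simpa [expMonCoeffR] using mem_zeroI S, ?_⟩
    have := encl_map_divNat hrow (n := 2 * M) (by omega)
    refine this.congr' fun i ↦ ?_
    simp only [expMonCoeffR, show 1 ≤ i + 1 from by omega, if_true, Nat.add_sub_cancel]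
    push_cast
    ring
  -- D: the Bernoulli terms
  have hG := encl_gListMI hS₂ S (encl_betaList (S * 2 ^ E) (q := q) hM0 hcs) (length_betaList _ _ _ _ _)
  have hD := encl_dPass hS hG (fun j ↦ (-Real.log (M : ℝ)) ^ j / j !) (trow S (Ls.getD (M - 1) zeroI).neg (len + 1))
    [] 0 (hrow.congr' fun j ↦ by simp) rfl trivial
  have hP := encl_addL (encl_addL (encl_addL hA hB) hC) hD
  refine (show progCoeffs S E len q m N ν cs (pochRows ν) Ls = _ from rfl) ▸ hP.congr' fun i ↦ ?_
  rw [progCoeffR_eq, length_gListMI, zero_add, sum_range_min]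
  simp only [hM]
  congr 1
  refine sum_congr rfl fun l hl ↦ ?_
  simp only [expMonCoeffR]
  split_ifs with h1 h2 h2
  · rw [show i - (l + 1) = i - 1 - l from by omega]
  · omega
  · omega
  · simp

end Summit.RiemannHypothesis.RiemannHypothesis.Theorems.LiDirichletKernel
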